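import Summits.CriticalPhenomena.Ising3DConformalLimit.Theorems.SubPtolemyInterlacingInterlacingForcesU4
import Summits.CriticalPhenomena.Ising3DConformalLimit.Theorems.SubPtolemyFloor.Negative.ExponentCharacterisation
import Summits.CriticalPhenomena.Ising3DConformalLimit.Theses.AnomalousForcesInteraction
import HarnessLib

/-!
# `SubPtolemyFloor` (item stmt-CriticalPhenomena-15703) is DISPENSABLE for route `SubPtolemyInterlacing`:
# the floor-free ("hybrid") closing of the conjunct

THEOREM-ONLY file (no definitions, no named facts), line `HybridCloses` of the crux
`Summit.CriticalPhenomena.Ising3DConformalLimit.Theses.SubPtolemyInterlacing.SubPtolemyFloor` (r3).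

The landed proof of r5 `interlacingForcesU4_proof` uses the axial floor r3 for ONE purpose: to put the
scaling dimension of the limit into the sub-Ptolemy window, `2Δ ≤ a < log₂(1+√2)`. This file factors that
out:

* `hasNontrivialU4_of_interlacing_of_window` — `Interlacing` alone forces `U₄ ≢ 0` for every
  non-degenerate, translation-invariant, scale-covariant pointwise scaling limit of `criticalCorr 3` whose
  dimension satisfies `2Δ < log₂(1+√2)` (no floor; the window is the hypothesis).
* `hasNontrivialU4_of_interlacing_of_gaussianWindow` — hence `Interlacing` and the GAUSSIAN-WINDOW
  statement "every such limit with `U₄ ≡ 0` has `2Δ < log₂(1+√2)`" force `U₄ ≢ 0` for EVERY such limit,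
  whatever its dimension: if the limit had `U₄ ≡ 0`, its dimension would sit in the window, where
  `Interlacing` forces `U₄ ≢ 0` — contradiction.
* `hybrid_closes` — `Interlacing → AnomalousForcesInteraction.GaussianLimitIsFree → MoebiusLimit →
  Ising3DConformalLimit`: the crux `GaussianLimitIsFree` (item stmt-CriticalPhenomena-2601,
  "`U₄ ≡ 0 ⇒ Δ = 1/2`") of the sibling route `AnomalousForcesInteraction` discharges the Gaussian window
  because `2·(1/2) = 1 < log₂(1+√2)` (the landed `SubPtolemyFloorNegative.one_lt_threshold`),
  and the Möbius witness of `MoebiusLimit` supplies translation invariance and scale covariance.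

So the summit conjunct is reachable from `Interlacing ∧ GaussianLimitIsFree ∧ MoebiusLimit` with no
two-point lower bound at all; whether to re-route is planner business (D-0019) — this file only makes the
implication kernel-checked and importable.

References (informal provenance; every input is a theorem of the tree or a hypothesis):
Duminil-Copin ICM 2022 §8.1 (scaling-limit covariance bookkeeping); Aizenman CMP 86 (1982) §1 (`U₄`);
Newman CMP 41 (1975) (Gaussian = vanishing `U₄` in the Lee–Yang class, the content behind item 2601).
-/

noncomputable section

namespace Summit.CriticalPhenomena.Ising3DConformalLimit.SubPtolemyFloorHybrid

open Filter Topology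
open Literature.Probability.LatticeModels
open Summit.CriticalPhenomena.Ising3DConformalLimit.Theses
open Summit.CriticalPhenomena.Ising3DConformalLimit.Theses.SubPtolemyInterlacing
open Summit.CriticalPhenomena.Ising3DConformalLimit.Theorems
open EuclideanSpace (single)

/-- **`Interlacing` forces `U₄ ≢ 0` inside the sub-Ptolemy window.** For every renormalisation `ρ > 0` on
`(0,1]`, every `Δ` with `2Δ < log₂(1+√2)` and every pointwise scaling limit `S` of `criticalCorr 3` that is
non-degenerate, translation invariant and scale covariant with dimension `Δ`: `HasNontrivialU4 S`. Same
computation as `interlacingForcesU4_proof` at the Ptolemy-balanced configuration `x⋆ = (0,2,3,6)·e₁`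
(`U₄(x⋆) ≤ s₁ s₃ (1 - 2u - u²)`, `u = 2^{-2Δ} > √2 - 1`), with the window as a hypothesis instead of the
axial floor. [cite: DuminilCopinICM2022, §8.1] [cite: Aizenman1982, §1] -/
theorem hasNontrivialU4_of_interlacing_of_window (hI : Interlacing) {ρ : ℝ → ℝ} {Δ : ℝ}
    {S : CorrFamily 3} (hlim : HasPointwiseScalingLimit (criticalCorr 3) ρ S)
    (hnd : IsNondegenerateTwoPoint S) (htr : IsTranslationInvariant S) (hsc : IsScaleCovariant Δ S)
    (hΔ : 2 * Δ < Real.logb 2 (1 + Real.sqrt 2)) : HasNontrivialU4 S := by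
  -- the doubling ratio `u = 2^{-2Δ}` and its lower bound from the window
  set u : ℝ := (2:ℝ) ^ (-(2:ℝ) * Δ) with hu
  have hu0 : 0 < u := Real.rpow_pos_of_pos (by norm_num) _
  have huroot : Real.sqrt 2 - 1 < u :=
    interlacingForcesU4_sqrt_two_sub_one_lt_doublingRatio hΔ le_rfl
  -- the two positive numbers `s₁ = S₂(0,e₁)`, `s₃ = S₂(0,3e₁)`
  have hs1 : 0 < S 2 ![0, single 0 1] := hnd _ (zero_unitVec_mem_nonCoincident one_ne_zero)
  have hs3 : 0 < S 2 ![0, single 0 3] := hnd _ (zero_unitVec_mem_nonCoincident (by norm_num))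
  -- doubling (scale covariance at `c = 2`) and axis translations: the six pair values at `x⋆`
  have e01 : S 2 ![0, single 0 2] = u * S 2 ![0, single 0 1] := by
    have h := interlacingForcesU4_S_two_axis_double hsc 1
    rw [mul_one] at h
    rw [hu]; exact h
  have hd2 : S 2 ![0, single 0 4] = u * S 2 ![0, single 0 2] := by
    have h := interlacingForcesU4_S_two_axis_double hsc 2
    rw [show (2:ℝ) * 2 = 4 by norm_num] at h
    rw [hu]; exact h
  have e03 : S 2 ![0, single 0 6] = u * S 2 ![0, single 0 3] := by
    have h := interlacingForcesU4_S_two_axis_double hsc 3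
    rw [show (2:ℝ) * 3 = 6 by norm_num] at h
    rw [hu]; exact h
  have e13 : S 2 ![single 0 2, single 0 6] = u ^ 2 * S 2 ![0, single 0 1] := by
    have h := interlacingForcesU4_S_two_axis_translate htr 2 6
    rw [show (6:ℝ) - 2 = 4 by norm_num] at h
    rw [h, hd2, e01]; ring
  have e23 : S 2 ![single 0 3, single 0 6] = S 2 ![0, single 0 3] := by
    have h := interlacingForcesU4_S_two_axis_translate htr 3 6
    rwa [show (6:ℝ) - 3 = 3 by norm_num] at h
  have e12 : S 2 ![single 0 2, single 0 3] = S 2 ![0, single 0 1] := by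
    have h := interlacingForcesU4_S_two_axis_translate htr 2 3
    rwa [show (3:ℝ) - 2 = 1 by norm_num] at h
  -- the limit sub-Ptolemy inequality at `x⋆`, in the `(s₁, s₃, u)` bookkeeping
  have hspc := interlacingForcesU4_limit_subPtolemy hI hlim
  rw [e01, e23, e13, e03, e12] at hspc
  -- conclude: `U₄(x⋆) < 0`
  refine ⟨![0, single 0 2, single 0 3, single 0 6], interlacingForcesU4_xStar_mem_nonCoincident,
    ne_of_lt ?_⟩
  show S 4 ![0, single 0 2, single 0 3, single 0 6] -
      (S 2 ![0, single 0 2] * S 2 ![single 0 3, single 0 6] +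
        S 2 ![0, single 0 3] * S 2 ![single 0 2, single 0 6] +
        S 2 ![0, single 0 6] * S 2 ![single 0 2, single 0 3]) < 0
  rw [e01, e23, e13, e03, e12]
  exact interlacingForcesU4_u4_balanced_neg hs1 hs3 hu0 huroot hspc

/-- **Floor-free non-Gaussianity, Gaussian-window form.** `Interlacing` and the statement "every
non-degenerate, translation-invariant, scale-covariant pointwise scaling limit of `criticalCorr 3` with
`U₄ ≡ 0` has `2Δ < log₂(1+√2)`" force `U₄ ≢ 0` for every such limit `(ρ, Δ, S)`: either `U₄ ≢ 0`
already, or the limit sits in the window where `Interlacing` forces `U₄ ≢ 0`. No two-point lower bound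
is used. [cite: DuminilCopinICM2022, §8.1] -/
theorem hasNontrivialU4_of_interlacing_of_gaussianWindow (hI : Interlacing)
    (hGW : ∀ (ρ : ℝ → ℝ) (Δ : ℝ) (S : CorrFamily 3), (∀ δ ∈ Set.Ioc (0:ℝ) 1, 0 < ρ δ) →
      HasPointwiseScalingLimit (criticalCorr 3) ρ S → IsNondegenerateTwoPoint S →
      IsTranslationInvariant S → IsScaleCovariant Δ S → ¬ HasNontrivialU4 S →
      2 * Δ < Real.logb 2 (1 + Real.sqrt 2))
    {ρ : ℝ → ℝ} {Δ : ℝ} {S : CorrFamily 3} (hρ : ∀ δ ∈ Set.Ioc (0:ℝ) 1, 0 < ρ δ)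
    (hlim : HasPointwiseScalingLimit (criticalCorr 3) ρ S) (hnd : IsNondegenerateTwoPoint S)
    (htr : IsTranslationInvariant S) (hsc : IsScaleCovariant Δ S) : HasNontrivialU4 S := by
  by_contra hU
  exact hU (hasNontrivialU4_of_interlacing_of_window hI hlim hnd htr hsc
    (hGW ρ Δ S hρ hlim hnd htr hsc hU))

/-- **HybridCloses: `Interlacing → GaussianLimitIsFree → MoebiusLimit → Ising3DConformalLimit`.** The crux
`GaussianLimitIsFree` of route `AnomalousForcesInteraction` (item stmt-CriticalPhenomena-2601: a limit with
`U₄ ≡ 0` has `Δ = 1/2`) discharges the Gaussian window, since `2·(1/2) = 1 < log₂(1+√2)`; applied to the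
Möbius witness of `MoebiusLimit` (translation invariance and scale covariance read off Möbius covariance)
this gives clause (iii), so the conjunct follows WITHOUT the axial floor `SubPtolemyFloor` (r3). [cite: Newman1975, Theorem 6 (Gaussian ⇔ vanishing fourth cumulant in the Lee–Yang class)] -/
theorem hybrid_closes :
    Interlacing → AnomalousForcesInteraction.GaussianLimitIsFree → MoebiusLimit →
      _root_.Ising3DConformalLimit := by
  intro hI hGF hML
  obtain ⟨ρ, Δ, S, hρ, hΔ, hlim, hnd, hmob⟩ := hML
  refine ⟨ρ, Δ, S, hρ, hΔ, hlim, hnd, hmob, ?_⟩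
  refine hasNontrivialU4_of_interlacing_of_gaussianWindow hI ?_ hρ hlim hnd hmob.1.1 hmob.2.1
  intro ρ' Δ' S' hρ' hlim' hnd' htr' hsc' hU'
  have hhalf : Δ' = 1 / 2 := hGF ρ' Δ' S' hρ' hlim' hnd' htr' hsc' hU'
  rw [hhalf]
  linarith [SubPtolemyFloorNegative.one_lt_threshold]

/-! ## The weakest two-point statement the route consumes: the CONDITIONAL exponent inequality

Inside the route the limit of `MoebiusLimit` exists, so the anomalous dimension `η(3)` exists
(`HasPointwiseScalingLimit.hasIsingExponentEta`, `η = 2Δ - 1` by uniqueness of the covariance exponent)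
and r3 is consumed only through `2Δ < log₂(1+√2)`. Hence the conditional inequality
"`∀ η, HasIsingExponentEta 3 η → η < log₂(1+√2) - 1`" — the converse shape of Duminil-Copin–Panis 2025,
Theorem 1.5 (`η ≤ 1/2` IF `η` exists; tree `dcp_isingEta_le_half_holds`) with `1/2` replaced by
`0.2716` — already closes the route with `Interlacing` and `MoebiusLimit`, and it is implied by r3
(`conditionalEta_of_subPtolemyFloor`). It is still open (truth `η = 0.036`), but it is the honest
residual: no all-`n` floor, no constant, no subsequence bookkeeping. -/

/-- **`η = 2Δ - 1` exists for a non-degenerate `IsScaleCovariant Δ` pointwise limit of `criticalCorr 3`**: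
the tree's `exists_rpow_scale_and_ratio` produces a covariance exponent `Δ₂` with the Lamperti ratio
clause, `Δ₂ = Δ` by reading both covariances at the reference pair and scale `2`, and
`HasPointwiseScalingLimit.hasIsingExponentEta` gives the exponent. [cite: DuminilCopin2019, Exercise 37 (4), eq. (4.10), §4.3] -/
theorem hasIsingExponentEta_of_scaleCovariant_limit {ρ : ℝ → ℝ} {S : CorrFamily 3} {Δ : ℝ}
    (hρ : ∀ δ ∈ Set.Ioc (0:ℝ) 1, 0 < ρ δ) (hlim : HasPointwiseScalingLimit (criticalCorr 3) ρ S)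
    (hnd : IsNondegenerateTwoPoint S) (hsc : IsScaleCovariant Δ S) :
    HasIsingExponentEta 3 (2 * Δ - 1) := by
  obtain ⟨Δ₂, -, hcov₂, hratio⟩ := hlim.exists_rpow_scale_and_ratio (by norm_num) hρ hnd
  have hx₀ := refPair_mem_nonCoincident (d := 3) (by norm_num)
  set x₀ : Fin 2 → EuclideanSpace ℝ (Fin 3) :=
    ![0, EuclideanSpace.single (⟨0, by norm_num⟩ : Fin 3) (1:ℝ)] with hx₀def
  have ha : 0 < S 2 x₀ := hnd _ hx₀
  have heq : Δ₂ = Δ := by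
    have e₁ := hsc 2 2 two_pos x₀
    have e₂ := hcov₂ 2 2 two_pos x₀ hx₀
    rw [e₁] at e₂
    have h1 := mul_right_cancel₀ ha.ne' e₂
    have hl : 0 < Real.log 2 := Real.log_pos one_lt_two
    have h' := congrArg Real.log h1
    rw [Real.log_rpow two_pos, Real.log_rpow two_pos] at h'
    have h'' := mul_right_cancel₀ hl.ne' h'
    push_cast at h''
    linarith
  subst heq
  exact hlim.hasIsingExponentEta hρ hnd (hratio (1/2) (by norm_num))

/-- **`Interlacing` + the conditional exponent inequality force `U₄ ≢ 0`** for every non-degenerate,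
translation-invariant, scale-covariant pointwise limit with renormalisation `ρ > 0` on `(0,1]`: the limit
makes `η = 2Δ - 1` exist, the hypothesis gives `2Δ < log₂(1+√2)`, and
`hasNontrivialU4_of_interlacing_of_window` concludes. [cite: DuminilCopinICM2022, §8.1] -/
theorem hasNontrivialU4_of_interlacing_of_conditionalEta (hI : Interlacing)
    (hC : ∀ η : ℝ, HasIsingExponentEta 3 η → η < Real.logb 2 (1 + Real.sqrt 2) - 1)
    {ρ : ℝ → ℝ} {Δ : ℝ} {S : CorrFamily 3} (hρ : ∀ δ ∈ Set.Ioc (0:ℝ) 1, 0 < ρ δ)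
    (hlim : HasPointwiseScalingLimit (criticalCorr 3) ρ S) (hnd : IsNondegenerateTwoPoint S)
    (htr : IsTranslationInvariant S) (hsc : IsScaleCovariant Δ S) : HasNontrivialU4 S := by
  have hlt := hC _ (hasIsingExponentEta_of_scaleCovariant_limit hρ hlim hnd hsc)
  exact hasNontrivialU4_of_interlacing_of_window hI hlim hnd htr hsc (by linarith)

/-- **ConditionalEtaCloses: `Interlacing → (η(3) exists ⇒ η(3) < log₂(1+√2) - 1) → MoebiusLimit →
Ising3DConformalLimit`** — the route's deciding shape with r3 replaced by the conditional exponent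
inequality (no floor constant, no all-`n` clause). [cite: DuminilCopinPanis2025LowerBounds, Theorem 1.5] -/
theorem conditionalEta_closes :
    Interlacing → (∀ η : ℝ, HasIsingExponentEta 3 η → η < Real.logb 2 (1 + Real.sqrt 2) - 1) →
      MoebiusLimit → _root_.Ising3DConformalLimit := by
  intro hI hC hML
  obtain ⟨ρ, Δ, S, hρ, hΔ, hlim, hnd, hmob⟩ := hML
  exact ⟨ρ, Δ, S, hρ, hΔ, hlim, hnd, hmob,
    hasNontrivialU4_of_interlacing_of_conditionalEta hI hC hρ hlim hnd hmob.1.1 hmob.2.1⟩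

/-- **r3 implies the conditional exponent inequality** (so `conditionalEta_closes` weakens the route's
hypothesis): an `η` with `log ⟨σ₀σ_x⟩_{β_c} / log ‖x‖ → -(1+η)` restricts to the axis, and a floor with
exponent `a < log₂(1+√2)` forces `1 + η ≤ a` (`SubPtolemyFloorNegative.exponent_le_of_floor`). [folklore] -/
theorem conditionalEta_of_subPtolemyFloor (h : SubPtolemyFloor) :
    ∀ η : ℝ, HasIsingExponentEta 3 η → η < Real.logb 2 (1 + Real.sqrt 2) - 1 := by
  intro η hη
  have hsp : HasSpatialDecayExponent (criticalTwoPoint 3) (((3 : ℕ) : ℝ) - 2 + η) := hη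
  -- restrict the spatial exponent to the first axis (`‖m e₁‖ = m`, `m ↦ m e₁` injective)
  have hf : Function.Injective (fun m : ℕ => (Pi.single 0 (m : ℤ) : Site 3)) :=
    fun m₁ m₂ hm => by
      have := congr_fun hm 0
      simpa using this
  have h2 := hsp.comp hf.tendsto_cofinite
  rw [Nat.cofinite_eq_atTop] at h2
  have hax : HasDecayExponent (fun m : ℕ => criticalTwoPoint 3 (Pi.single 0 (m : ℤ)))
      (((3 : ℕ) : ℝ) - 2 + η) := by
    refine h2.congr' (Eventually.of_forall fun m => ?_)
    simp only [Function.comp_apply, Pi.norm_single, Int.norm_natCast]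
  have hlt := SubPtolemyFloorNegative.exponent_lt_threshold_of_crux hax h
  push_cast at hlt
  linarith

end Summit.CriticalPhenomena.Ising3DConformalLimit.SubPtolemyFloorHybrid

end
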